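import Literature.Topology.FourManifolds.HCobordismSlideStepSplit
import Literature.Topology.FourManifolds.HCobordismSlideStepFlowRegularDatum
import HarnessLib

/-!
# Milnor 1965, proof of Thm. 7.6 (PDF p. 52): *"`D_L'(p₁)` intersects `D_R(p₂)` in a single
# point, transversely"* — the transverse value `D_R(p₂) · D_L'(p₁) = ±1` at the crossing

Topic `Literature/Topology/FourManifolds`; sequel to `HCobordismSlideStepSplit.lean` for the
named fact `Literature.Topology.FourManifolds.Cobordism.Milnor1965_basisTheorem_slab` (Milnor,
*Lectures on the h-cobordism theorem* (1965), Thm. 7.6 on a slab).  That file reduced Thm. 7.6 on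
a slab to two hypotheses, `HV` (the functional of a transverse disc datum of `D_R(σ j)` takes the
value `± w₀` on the class of the slid disc `D_L'(σ i)`: *"in a single point, transversely"*) and
`HSgn` (the sign comparison of the two dockings: *"with intersection number `+1`"*).  This file
proves `HV`:

* **`Cobordism.slideStep_crossingValue`** — verbatim the hypothesis `HV` of
  `Cobordism.Milnor1965_basisTheorem_slab_of_crossingValue_of_crossingSign`;
* **`Cobordism.Milnor1965_basisTheorem_slab_of_crossingSign`** — Thm. 7.6 on a slab from `HSgn`
  alone.

Proof of `HV` (Milnor, PDF p. 52 of the held copy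
`lit read book:milnornd-lectures-h-cobordism-theorem`; Thm. 3.4 for the product structure of the
band, Def. 3.9 / Thm. 4.1 for the normal coordinate).  Take the flow-regular datum `Tⱼ` of
`D_R(σ j)` (`Cobordism.exists_flowRegular_transverseDiscDatum`, its box inside `{g₁ < c₀}`, so
that its regular region `R` contains `D_R(σ j)` from the level `V₀ = {g₁ = c₀}` up to the level
`c₁`) and the Euclidean model `E : ℝᵏ ⊇ V → D_L'(σ i)` of the slid disc about the crossing point
`y⋆ = E p⋆` (`SlideSetting.exists_crossingChart`).  By `Cobordism.functional_newDisc_crossing_eq_or_eq_neg'`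
it suffices that the normal coordinate `K̃ⱼ ∘ E` has an invertible derivative at `p⋆`.  Near
`p⋆ = L_k(a⋆, 0)`, flow invariance of `K̃ⱼ` and the formula of the isotopy near the docking
centre (`exists_slidePair`: *"`F_t(discA ρ v) = Φ⁻¹(1 + λ(2t-1)(α - 1), x(v), 0)`"*, `α = 5/2`
there) give

  `K̃ⱼ (E (L_k(a, x))) = G (1 + (3/2) λ(2ν(a) - 1), X(x), 0)`,  `G := K̃ⱼ ∘ ι ∘ Φ⁻¹`,

with `X` the sheet coordinate of the docking disc (a local diffeomorphism of `ℝ^{k-1}` at `0`: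
`SlideSetting.exists_hasFDerivAt_sheetCoord`) and `a ↦ 1 + (3/2) λ(2ν(a) - 1)` of non-zero
derivative at `a⋆` (`hasDerivAt_sweepProfile`: `λ' > 0` on `(0, 1)`, `PlanarArch.lean`).  The
map `G` is smooth at `z⋆ = (2, 0, 0)`, vanishes on `{(2, 0, y)}` (these points lie on
`S_R(σ j)`), and its derivative at `z⋆` is onto: the right-inverse germ `m` of `K̃ⱼ` at `y⋆`
(full rank on the stratum), projected to the level `V₀` along the flow (`Flow.prodInv`,
`SlabProduct.lean`, Thm. 3.4) and read in the chart `Φ`, is a right inverse of `G`.  Hence the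
derivative of `G` restricted to the `(s, x)`-plane is an isomorphism onto `ℝᵏ`
(`crossing_det_ne_zero`, rank count), and so is the derivative of `K̃ⱼ ∘ E` at `p⋆`.

Everything here is proved; no definitions, no named facts.

## References

* J. Milnor, *Lectures on the h-cobordism theorem*, notes by L. Siebenmann and J. Sondow,
  Princeton Mathematical Notes (1965): Def. 3.9 (PDF p. 16), Thm. 3.4 (PDF pp. 12–13), Thm. 4.1
  (PDF p. 22), Lemma 7.7 and the proof of Thm. 7.6 (PDF pp. 50–52).  Held:
  `lit read book:milnornd-lectures-h-cobordism-theorem`. [MilnorHCobordism1965]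
* A. Hatcher, *Algebraic Topology*, CUP 2002, Thm. 2.20, §3.3 pp. 233–236. [HatcherAT2002]
-/

open scoped Manifold ContDiff Topology
open Set Function Filter Metric CategoryTheory OpenPartialHomeomorph
open Literature.AlgebraicTopology.SingularHomology

noncomputable section

namespace Literature.Topology.FourManifolds

universe u

/-! ### Two lemmas of calculus and linear algebra -/

/-- **The sweep profile has non-zero (negative) derivative at the crossing height**: for
`ν(a) = λ((t₂' - a)/(t₂' - t₁'))` (`λ = Real.smoothTransition`, `t₁' < t₂'`) and a height `a⋆`
with `λ(2ν(a⋆) - 1) = 2/3`, the function `a ↦ 1 + λ(2ν(a) - 1)(5/2 - 1)` (the `s`-coordinate of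
the swept docking centre) has a negative derivative at `a⋆` (`λ' > 0` on `(0, 1)`,
`deriv_smoothTransition_pos`). [folklore] -/
theorem hasDerivAt_sweepProfile {t₁' t₂' astar : ℝ} (h12 : t₁' < t₂')
    (hlam : Real.smoothTransition (2 * Real.smoothTransition ((t₂' - astar) / (t₂' - t₁')) - 1) = 2 / 3) :
    ∃ d : ℝ, d < 0 ∧ HasDerivAt (fun a' : ℝ => 1 + Real.smoothTransition
        (2 * Real.smoothTransition ((t₂' - a') / (t₂' - t₁')) - 1) * (5 / 2 - 1)) d astar := by
  have h21 : 0 < t₂' - t₁' := by linarith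
  have hI := SlideSetting.mem_Ioo_of_smoothTransition_mem_Ioo
    (x := 2 * Real.smoothTransition ((t₂' - astar) / (t₂' - t₁')) - 1)
    (by rw [hlam]; norm_num) (by rw [hlam]; norm_num)
  have hLu : 0 < Real.smoothTransition ((t₂' - astar) / (t₂' - t₁')) ∧
      Real.smoothTransition ((t₂' - astar) / (t₂' - t₁')) < 1 :=
    ⟨by linarith [hI.1], by linarith [hI.2]⟩
  have hu01 := SlideSetting.mem_Ioo_of_smoothTransition_mem_Ioo hLu.1 hLu.2
  have hd1 : 0 < deriv Real.smoothTransition ((t₂' - astar) / (t₂' - t₁')) :=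
    deriv_smoothTransition_pos hu01.1 hu01.2
  have hd2 : 0 < deriv Real.smoothTransition
      (2 * Real.smoothTransition ((t₂' - astar) / (t₂' - t₁')) - 1) :=
    deriv_smoothTransition_pos hI.1 hI.2
  have hL : ∀ y, HasDerivAt Real.smoothTransition (deriv Real.smoothTransition y) y := fun y =>
    ((Real.smoothTransition.contDiff (n := 1)).differentiable (by simp) y).hasDerivAt
  have hin : HasDerivAt (fun a' : ℝ => (t₂' - a') / (t₂' - t₁')) (-1 / (t₂' - t₁')) astar :=
    ((hasDerivAt_id astar).const_sub t₂').div_const (t₂' - t₁')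
  have hν := (hL _).comp astar hin
  have h2ν := (hν.const_mul 2).sub_const 1
  have hlam2 := (hL _).comp astar h2ν
  refine ⟨_, ?_, (hlam2.mul_const (5 / 2 - 1)).const_add 1⟩
  show deriv Real.smoothTransition (2 * Real.smoothTransition ((t₂' - astar) / (t₂' - t₁')) - 1) *
      (2 * (deriv Real.smoothTransition ((t₂' - astar) / (t₂' - t₁')) * (-1 / (t₂' - t₁')))) *
      (5 / 2 - 1) < 0
  have hneg : deriv Real.smoothTransition ((t₂' - astar) / (t₂' - t₁')) * (-1 / (t₂' - t₁')) < 0 :=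
    mul_neg_of_pos_of_neg hd1 (div_neg_of_neg_of_pos (by norm_num) h21)
  nlinarith

/-- **Rank count at the crossing**: let `G' : ℝ × ℝ^{k-1} × ℝᵐ → ℝᵏ` be linear with a right
inverse `m'` and vanishing on `0 × 0 × ℝᵐ`; then `G'` restricted to `ℝ × ℝ^{k-1} × 0` is onto,
hence one-to-one (`1 + (k - 1) = k`), and its composite with `p ↦ (d a, X' x, 0)`
(`(a, x) = Λ p`, `d ≠ 0`, `X'` one-to-one, `Λ` an isomorphism) has non-zero determinant.
[folklore] -/
theorem crossing_det_ne_zero {k m : ℕ} (hk : 1 ≤ k)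
    (G' : (ℝ × EuclideanSpace ℝ (Fin (k - 1)) × EuclideanSpace ℝ (Fin m)) →L[ℝ] EuclideanSpace ℝ (Fin k))
    (m' : EuclideanSpace ℝ (Fin k) →L[ℝ] (ℝ × EuclideanSpace ℝ (Fin (k - 1)) × EuclideanSpace ℝ (Fin m)))
    (hGm : ∀ w, G' (m' w) = w)
    (hY : ∀ y, G' ((0 : ℝ), (0 : EuclideanSpace ℝ (Fin (k - 1))), y) = 0)
    {d : ℝ} (hd : d ≠ 0) (X' : EuclideanSpace ℝ (Fin (k - 1)) →L[ℝ] EuclideanSpace ℝ (Fin (k - 1)))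
    (hX' : Function.Injective X') (Λ : EuclideanSpace ℝ (Fin k) ≃L[ℝ] (ℝ × EuclideanSpace ℝ (Fin (k - 1)))) :
    LinearMap.det ((G'.comp ((d • ((ContinuousLinearMap.fst ℝ ℝ (EuclideanSpace ℝ (Fin (k - 1)))).comp
        (Λ : EuclideanSpace ℝ (Fin k) →L[ℝ] ℝ × EuclideanSpace ℝ (Fin (k - 1))))).prod
      ((X'.comp ((ContinuousLinearMap.snd ℝ ℝ (EuclideanSpace ℝ (Fin (k - 1)))).comp
        (Λ : EuclideanSpace ℝ (Fin k) →L[ℝ] ℝ × EuclideanSpace ℝ (Fin (k - 1))))).prod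
        (0 : EuclideanSpace ℝ (Fin k) →L[ℝ] EuclideanSpace ℝ (Fin m))))) :
        EuclideanSpace ℝ (Fin k) →ₗ[ℝ] EuclideanSpace ℝ (Fin k)) ≠ 0 := by
  -- the restriction of `G'` to the `(s, x)`-plane
  set G'' : (ℝ × EuclideanSpace ℝ (Fin (k - 1))) →ₗ[ℝ] EuclideanSpace ℝ (Fin k) :=
    (G' : _ →ₗ[ℝ] _).comp ((LinearMap.fst ℝ ℝ (EuclideanSpace ℝ (Fin (k - 1)))).prod
      ((LinearMap.snd ℝ ℝ (EuclideanSpace ℝ (Fin (k - 1)))).prod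
        (0 : (ℝ × EuclideanSpace ℝ (Fin (k - 1))) →ₗ[ℝ] EuclideanSpace ℝ (Fin m)))) with hG''
  have hG''apply : ∀ v : ℝ × EuclideanSpace ℝ (Fin (k - 1)),
      G'' v = G' (v.1, v.2, (0 : EuclideanSpace ℝ (Fin m))) := fun v => rfl
  have hsurj : Surjective G'' := by
    intro w
    refine ⟨((m' w).1, (m' w).2.1), ?_⟩
    have hsplit : (m' w) = (((m' w).1, (m' w).2.1, (0 : EuclideanSpace ℝ (Fin m))) : ℝ × _ × _) +
        ((0 : ℝ), (0 : EuclideanSpace ℝ (Fin (k - 1))), (m' w).2.2) := by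
      ext <;> simp
    calc G'' ((m' w).1, (m' w).2.1)
        = G' ((m' w).1, (m' w).2.1, (0 : EuclideanSpace ℝ (Fin m))) := rfl
      _ = G' ((m' w).1, (m' w).2.1, (0 : EuclideanSpace ℝ (Fin m))) +
            G' ((0 : ℝ), (0 : EuclideanSpace ℝ (Fin (k - 1))), (m' w).2.2) := by rw [hY, add_zero]
      _ = G' ((((m' w).1, (m' w).2.1, (0 : EuclideanSpace ℝ (Fin m))) : ℝ × _ × _) +
            ((0 : ℝ), (0 : EuclideanSpace ℝ (Fin (k - 1))), (m' w).2.2)) := by rw [map_add]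
      _ = G' (m' w) := by rw [← hsplit]
      _ = w := hGm w
  have hdim : Module.finrank ℝ (ℝ × EuclideanSpace ℝ (Fin (k - 1))) =
      Module.finrank ℝ (EuclideanSpace ℝ (Fin k)) := by
    simp only [Module.finrank_prod, Module.finrank_self, finrank_euclideanSpace_fin]
    omega
  have hinj'' : Injective G'' := (LinearMap.injective_iff_surjective_of_finrank_eq_finrank hdim).2 hsurj
  -- the composite is injective
  set L : EuclideanSpace ℝ (Fin k) →L[ℝ] EuclideanSpace ℝ (Fin k) :=
    G'.comp ((d • ((ContinuousLinearMap.fst ℝ ℝ (EuclideanSpace ℝ (Fin (k - 1)))).comp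
        (Λ : EuclideanSpace ℝ (Fin k) →L[ℝ] ℝ × EuclideanSpace ℝ (Fin (k - 1))))).prod
      ((X'.comp ((ContinuousLinearMap.snd ℝ ℝ (EuclideanSpace ℝ (Fin (k - 1)))).comp
        (Λ : EuclideanSpace ℝ (Fin k) →L[ℝ] ℝ × EuclideanSpace ℝ (Fin (k - 1))))).prod
        (0 : EuclideanSpace ℝ (Fin k) →L[ℝ] EuclideanSpace ℝ (Fin m)))) with hLdef
  have hLapply : ∀ v, L v = G'' (d * (Λ v).1, X' (Λ v).2) := fun v => rfl
  have hinj : Function.Injective (L : EuclideanSpace ℝ (Fin k) →ₗ[ℝ] EuclideanSpace ℝ (Fin k)) := by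
    intro v w hvw
    have h1 : L v = L w := hvw
    rw [hLapply, hLapply] at h1
    have h2 := hinj'' h1
    simp only [Prod.mk.injEq] at h2
    have h3 : (Λ v).1 = (Λ w).1 := mul_left_cancel₀ hd h2.1
    have h4 : (Λ v).2 = (Λ w).2 := hX' h2.2
    exact Λ.injective (Prod.ext h3 h4)
  have hunit : IsUnit (L : EuclideanSpace ℝ (Fin k) →ₗ[ℝ] EuclideanSpace ℝ (Fin k)) :=
    (LinearMap.isUnit_iff_ker_eq_bot _).2 (LinearMap.ker_eq_bot.2 hinj)
  exact (hunit.map LinearMap.det).ne_zero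

/-! ### The sheet coordinate of the docking disc -/

section Setting

variable {n : ℕ} {M N : Type u} [TopologicalSpace M] [ChartedSpace (EuclideanSpace ℝ (Fin n)) M]
  [TopologicalSpace N] [ChartedSpace (EuclideanSpace ℝ (Fin n)) N]

namespace SlideSetting

variable {c : Cobordism n M N} {g : c.W → ℝ}
  {ξ : Cₛ^∞⟮𝓡∂ (n + 1); EuclideanSpace ℝ (Fin (n + 1)), (TangentSpace (𝓡∂ (n + 1)) : c.W → Type)⟯}
  {t₀ t₁ b : ℝ} {k a : ℕ} {σ : Fin a → c.W} {i j : Fin a}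
  (S : SlideSetting c g ξ t₀ t₁ b k σ i j)

/-- `preB` is smooth. [folklore] -/
theorem contDiff_preB : ContDiff ℝ ∞ S.preB := by
  show ContDiff ℝ ∞ fun v : EuclideanSpace ℝ (Fin n) =>
    (((1 : ℝ), (0 : EuclideanSpace ℝ (Fin (k - 1))), (0 : EuclideanSpace ℝ (Fin (n - k)))) : Model n k) +
      S.L₃ (univBall (0 : EuclideanSpace ℝ (Fin n)) S.rB v)
  exact contDiff_const.add (S.L₃.contDiff.comp contDiff_univBall)

/-- **The flat vector docked at the sheet point `x`**: for `x` with `L₃⁻¹(0, x, 0) ∈ B(0, r_A)`,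
the vector `v = (univBall 0 r_A)⁻¹ (L₃⁻¹(0, x, 0))` is flat and `discA ρ v = ψ_L^ρ(0, x, 0)`
(`preA v = (0, x, 0)`). [folklore] -/
theorem discA_symm_sheet (ρ : (EuclideanSpace ℝ (Fin (k - 1))) ≃ₗᵢ[ℝ] EuclideanSpace ℝ (Fin (k - 1)))
    {x : EuclideanSpace ℝ (Fin (k - 1))}
    (hx : S.L₃.symm (((0 : ℝ), x, (0 : EuclideanSpace ℝ (Fin (n - k)))) : Model n k) ∈
      ball (0 : EuclideanSpace ℝ (Fin n)) S.rA) :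
    S.discA ρ ((univBall (0 : EuclideanSpace ℝ (Fin n)) S.rA).symm
        (S.L₃.symm (((0 : ℝ), x, (0 : EuclideanSpace ℝ (Fin (n - k)))) : Model n k))) =
      S.psiL ρ (((0 : ℝ), x, (0 : EuclideanSpace ℝ (Fin (n - k)))) : Model n k) ∧
    (univBall (0 : EuclideanSpace ℝ (Fin n)) S.rA).symm
        (S.L₃.symm (((0 : ℝ), x, (0 : EuclideanSpace ℝ (Fin (n - k)))) : Model n k)) ∈ S.Flat := by
  have h1 : univBall (0 : EuclideanSpace ℝ (Fin n)) S.rA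
      ((univBall (0 : EuclideanSpace ℝ (Fin n)) S.rA).symm
        (S.L₃.symm (((0 : ℝ), x, (0 : EuclideanSpace ℝ (Fin (n - k)))) : Model n k))) =
      S.L₃.symm (((0 : ℝ), x, (0 : EuclideanSpace ℝ (Fin (n - k)))) : Model n k) :=
    (univBall (0 : EuclideanSpace ℝ (Fin n)) S.rA).right_inv (by rw [univBall_target _ S.rA_pos]; exact hx)
  have hA : S.discA ρ ((univBall (0 : EuclideanSpace ℝ (Fin n)) S.rA).symm
      (S.L₃.symm (((0 : ℝ), x, (0 : EuclideanSpace ℝ (Fin (n - k)))) : Model n k))) =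
      S.psiL ρ (((0 : ℝ), x, (0 : EuclideanSpace ℝ (Fin (n - k)))) : Model n k) := by
    rw [discA, preA, h1, ContinuousLinearEquiv.apply_symm_apply]
  refine ⟨hA, ?_⟩
  rw [← S.discA_mem_leftSphere_iff ρ, hA]
  exact S.psiL_sheet_mem_leftSphere ρ x

/-- **The sheet coordinate `X` of the docking disc is a local diffeomorphism of `ℝ^{k-1}` at `0`**:
`X(x) = x(preB(v))` for the flat vector `v` docked at the sheet point `x` (so that
`discA ρ v = ψ_L^ρ(0, x, 0)`, `discA_symm_sheet`) is differentiable at `0` with one-to-one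
derivative — it has the differentiable left inverse `x' ↦ x(L₃(univBall 0 r_A ((univBall 0 r_B)⁻¹
(L₃⁻¹(0, x', 0)))))` near `0` (the two squeezes preserve the flat). [folklore] -/
theorem exists_hasFDerivAt_sheetCoord :
    ∃ X' : EuclideanSpace ℝ (Fin (k - 1)) →L[ℝ] EuclideanSpace ℝ (Fin (k - 1)), Function.Injective X' ∧
      HasFDerivAt (fun x : EuclideanSpace ℝ (Fin (k - 1)) =>
        (S.preB ((univBall (0 : EuclideanSpace ℝ (Fin n)) S.rA).symm
          (S.L₃.symm (((0 : ℝ), x, (0 : EuclideanSpace ℝ (Fin (n - k)))) : Model n k)))).2.1) X' 0 := by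
  set uA := univBall (0 : EuclideanSpace ℝ (Fin n)) S.rA with huA
  set uB := univBall (0 : EuclideanSpace ℝ (Fin n)) S.rB with huB
  set emb : EuclideanSpace ℝ (Fin (k - 1)) → Model n k :=
    fun x => (((0 : ℝ), x, (0 : EuclideanSpace ℝ (Fin (n - k)))) : Model n k) with hemb
  set Xf : EuclideanSpace ℝ (Fin (k - 1)) → EuclideanSpace ℝ (Fin (k - 1)) :=
    fun x => (S.preB (uA.symm (S.L₃.symm (emb x)))).2.1 with hXf
  set Xi : EuclideanSpace ℝ (Fin (k - 1)) → EuclideanSpace ℝ (Fin (k - 1)) :=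
    fun x' => (S.L₃ (uA (uB.symm (S.L₃.symm (emb x'))))).2.1 with hXi
  have hembs : ContDiff ℝ ∞ emb := contDiff_const.prodMk (contDiff_id.prodMk contDiff_const)
  have hemb0 : S.L₃.symm (emb 0) = 0 := by
    show S.L₃.symm (((0 : ℝ), (0 : EuclideanSpace ℝ (Fin (k - 1))), (0 : EuclideanSpace ℝ (Fin (n - k)))) : Model n k) = 0
    exact map_zero _
  have hproj : ContDiff ℝ ∞ fun z : Model n k => z.2.1 := contDiff_fst.comp contDiff_snd
  -- `Xf` is differentiable at `0`
  have hA0 : uA.symm 0 = 0 := by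
    have h := uA.left_inv (x := 0) (by rw [huA, univBall_source]; trivial)
    rwa [huA, univBall_apply_zero] at h
  have hXf0 : Xf 0 = 0 := by
    show (S.preB (uA.symm (S.L₃.symm (emb 0)))).2.1 = 0
    rw [hemb0, hA0, S.preB_zero]
  have hAsymm : ContDiffAt ℝ ∞ uA.symm (S.L₃.symm (emb 0)) := by
    rw [hemb0, huA]
    exact contDiffOn_univBall_symm.contDiffAt (isOpen_ball.mem_nhds (mem_ball_self S.rA_pos))
  have hin : ContDiffAt ℝ ∞ (fun x => S.L₃.symm (emb x)) 0 := (S.L₃.symm.contDiff.comp hembs).contDiffAt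
  have hXfs : ContDiffAt ℝ ∞ Xf 0 :=
    hproj.contDiffAt.comp 0 (S.contDiff_preB.contDiffAt.comp 0
      (ContDiffAt.comp (f := fun x => S.L₃.symm (emb x)) 0 hAsymm hin))
  have hXd : HasFDerivAt Xf (fderiv ℝ Xf 0) 0 := (hXfs.differentiableAt (by simp)).hasFDerivAt
  -- `Xi` is differentiable at `Xf 0 = 0`
  have hBsymm : ContDiffAt ℝ ∞ uB.symm (S.L₃.symm (emb 0)) := by
    rw [hemb0, huB]
    exact contDiffOn_univBall_symm.contDiffAt (isOpen_ball.mem_nhds (mem_ball_self S.rB_pos))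
  have hXis : ContDiffAt ℝ ∞ Xi (Xf 0) := by
    rw [hXf0]
    have huAs : ContDiff ℝ ∞ uA := by rw [huA]; exact contDiff_univBall
    exact hproj.contDiffAt.comp 0 (S.L₃.contDiff.contDiffAt.comp 0
      (huAs.contDiffAt.comp 0 (ContDiffAt.comp (f := fun x => S.L₃.symm (emb x)) 0 hBsymm hin)))
  have hXid : HasFDerivAt Xi (fderiv ℝ Xi (Xf 0)) (Xf 0) := (hXis.differentiableAt (by simp)).hasFDerivAt
  -- `Xi ∘ Xf = id` near `0`
  have hball : ∀ᶠ x in 𝓝 (0 : EuclideanSpace ℝ (Fin (k - 1))),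
      S.L₃.symm (emb x) ∈ ball (0 : EuclideanSpace ℝ (Fin n)) S.rA := by
    have hc : ContinuousAt (fun x => S.L₃.symm (emb x)) 0 := hin.continuousAt
    apply hc.preimage_mem_nhds
    rw [hemb0]
    exact isOpen_ball.mem_nhds (mem_ball_self S.rA_pos)
  have hleft : ∀ᶠ x in 𝓝 (0 : EuclideanSpace ℝ (Fin (k - 1))), (Xi ∘ Xf) x = x := by
    filter_upwards [hball] with x hx
    set v := uA.symm (S.L₃.symm (emb x)) with hv
    have h1 : uA v = S.L₃.symm (emb x) := uA.right_inv (by rw [huA, univBall_target _ S.rA_pos]; exact hx)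
    have hvF : v ∈ S.Flat := (S.discA_symm_sheet 1 hx).2
    have h2 : S.preB v = ((1 : ℝ), (S.L₃ (uB v)).2.1, (0 : EuclideanSpace ℝ (Fin (n - k)))) :=
      S.preB_eq_of_mem_Flat hvF
    have h3 : uB v ∈ S.Flat := (slideSqueeze_mem_submodule_iff S.rB_pos S.Flat v).2 hvF
    rw [S.mem_Flat_iff] at h3
    have h4 : S.L₃.symm (emb (S.L₃ (uB v)).2.1) = uB v := by
      apply S.L₃.injective
      rw [ContinuousLinearEquiv.apply_symm_apply]
      exact Prod.ext h3.1.symm (Prod.ext rfl h3.2.symm)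
    have h5 : Xf x = (S.L₃ (uB v)).2.1 := by
      show (S.preB v).2.1 = _
      rw [h2]
    show Xi (Xf x) = x
    rw [h5]
    show (S.L₃ (uA (uB.symm (S.L₃.symm (emb (S.L₃ (uB v)).2.1))))).2.1 = x
    rw [h4, uB.left_inv (by rw [huB, univBall_source]; trivial), h1, ContinuousLinearEquiv.apply_symm_apply]
  have hcomp : HasFDerivAt (Xi ∘ Xf) ((fderiv ℝ Xi (Xf 0)).comp (fderiv ℝ Xf 0)) 0 := hXid.comp 0 hXd
  have hid : HasFDerivAt (Xi ∘ Xf) (ContinuousLinearMap.id ℝ _) 0 :=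
    (hasFDerivAt_id (0 : EuclideanSpace ℝ (Fin (k - 1)))).congr_of_eventuallyEq hleft
  have heq := hcomp.unique hid
  refine ⟨fderiv ℝ Xf 0, ?_, hXd⟩
  refine Function.LeftInverse.injective (g := fderiv ℝ Xi (Xf 0)) fun x => ?_
  have := congrArg (fun φ : EuclideanSpace ℝ (Fin (k - 1)) →L[ℝ] EuclideanSpace ℝ (Fin (k - 1)) => φ x) heq
  simpa using this

end SlideSetting

end Setting

/-! ### The transverse value at the crossing -/

set_option maxHeartbeats 1600000 in
/-- **`D_L'(p₁)` intersects `D_R(p₂)` in a single point, transversely** (Milnor 1965, proof of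
Thm. 7.6, PDF p. 52): the hypothesis `HV` of
`Cobordism.Milnor1965_basisTheorem_slab_of_crossingValue_of_crossingSign`, verbatim.  For a slide
setting `S` with `t₁ < 1`, a presentation `X` of the slab, a docking `ρ` and any outcome of the
geometric half (`SlideSetting.exists_slidePair ρ`), there is a transverse disc datum `Tⱼ` of
`D_R(σ j)` on `X` with the structural properties of `Cobordism.signDual_of_transverseDiscData`
(stratum the unstable set of `σ j`, centre `σ j`, disc in the stable set and a neighbourhood of
`σ j` within it, `disc ⊆ N`, `K ∘ m = id`) whose functional takes the value `w₀` or `-w₀` on the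
class in `H_k(X, A)` of every generator of `H_k(D_L'(σ i), S_L'(σ i))`, for every `A ⊆ X ∖ Pⱼ`
receiving the new left-hand sphere.  Proof: the flow-regular datum
(`Cobordism.exists_flowRegular_transverseDiscDatum`), the crossing chart
(`SlideSetting.exists_crossingChart`) and `Cobordism.functional_newDisc_crossing_eq_or_eq_neg'`,
the derivative of the normal coordinate along the chart being invertible (module docstring).
[cite: MilnorHCobordism1965, proof of Thm. 7.6 (PDF p. 52), Thm. 3.4 (PDF pp. 12–13), Def. 3.9 (PDF p. 16); HatcherAT2002, Thm. 2.20, §3.3 pp. 233–236] -/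
theorem Cobordism.slideStep_crossingValue :
    ∀ {n : ℕ} {M N : Type u} [TopologicalSpace M] [T2Space M] [SecondCountableTopology M]
      [ChartedSpace (EuclideanSpace ℝ (Fin n)) M] [IsManifold (𝓡 n) ∞ M] [CompactSpace M]
      [TopologicalSpace N] [T2Space N] [SecondCountableTopology N]
      [ChartedSpace (EuclideanSpace ℝ (Fin n)) N] [IsManifold (𝓡 n) ∞ N] [CompactSpace N]
      {c : Cobordism n M N} {g : c.W → ℝ}
      {ξ : Cₛ^∞⟮𝓡∂ (n + 1); EuclideanSpace ℝ (Fin (n + 1)), (TangentSpace (𝓡∂ (n + 1)) : c.W → Type)⟯}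
      {t₀ t₁ b : ℝ} {k a : ℕ} {σ : Fin a → c.W} {i j : Fin a}
      (S : SlideSetting c g ξ t₀ t₁ b k σ i j) (_ : t₁ < 1)
      {X : Set c.W} (_ : ∀ z, z ∈ X ↔ g z ∈ Icc t₀ t₁)
      (ρ : (EuclideanSpace ℝ (Fin (k - 1))) ≃ₗᵢ[ℝ] EuclideanSpace ℝ (Fin (k - 1))),
      ∀ (f : S.V ≃ₘ⟮𝓡 n, 𝓡 n⟯ S.V) (_ : Diffeomorph.IsCompactlyDiffeotopicToIdIn S.W f)
        (_ : ∀ v ∈ S.Flat, ‖v‖ ≤ 1 → f (S.discA ρ v) = S.discB v)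
        (Φ : OpenPartialHomeomorph S.V (SlideSetting.Model n k))
        (_ : ContMDiffOn (𝓡 n) 𝓘(ℝ, SlideSetting.Model n k) ∞ Φ Φ.source)
        (_ : ContMDiffOn 𝓘(ℝ, SlideSetting.Model n k) (𝓡 n) ∞ Φ.symm Φ.target)
        (_ : ∀ z, Φ.symm z ∈ S.rightSphere S.jR ↔ z.1 = 2 ∧ z.2.1 = 0)
        (_ : ∀ l, l ≠ S.jR → ∀ z, Φ.symm z ∉ S.rightSphere l)
        (O : Set (SlideSetting.Model n k)) (_ : IsOpen O) (_ : {z | z.1 = 2 ∧ z.2.1 = 0} ⊆ O)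
        (_ : ∀ z ∈ O, Φ.symm z = S.psiR z)
        (_ : ∀ v : EuclideanSpace ℝ (Fin n), ‖v‖ ≤ 1 / 8 →
          S.preB v ∈ Φ.target ∧ Φ.symm (S.preB v) = S.discB v)
        (r₀ : ℝ) (_ : 0 < r₀) (_ : {z : SlideSetting.Model n k | ‖z.2.2‖ < r₀} ⊆ Φ.target)
        (δ : ℝ) (α : ℝ → ℝ) (_ : 0 < δ) (_ : ContDiff ℝ ∞ α) (_ : ∀ u, u ≤ δ → α u = 5 / 2)
        (_ : ∀ u, 2 * δ ≤ u → α u = 1) (_ : ∀ u, 1 ≤ α u ∧ α u ≤ 5 / 2)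
        (F : AmbientIsotopy (𝓡 n) S.V)
        (_ : ∀ t, ∀ p ∈ S.leftSphere, ∀ l, F.toFun t p ∈ S.rightSphere l →
          l = S.jR ∧ p = S.discA ρ 0 ∧ 1 / 2 ≤ t ∧ Real.smoothTransition (2 * t - 1) = 2 / 3)
        (_ : ∀ t, 1 / 2 ≤ t → ∀ v ∈ S.Flat, ‖v‖ ≤ 1 / 8 →
          F.toFun t (S.discA ρ v) = Φ.symm
            ((1 + Real.smoothTransition (2 * t - 1) * (α (‖(S.preB v).2.1‖ ^ 2) - 1),
              (S.preB v).2.1, (0 : EuclideanSpace ℝ (Fin (n - k)))) : SlideSetting.Model n k))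
        (_ : ∀ t, t ≤ 1 / 2 → ∀ p ∈ S.W, F.toFun t p ∈ S.W)
        (_ : F.toFun 1 '' S.leftSphere ⊆ S.W)
        (ξ₃ : Cₛ^∞⟮𝓡∂ (n + 1); EuclideanSpace ℝ (Fin (n + 1)), (TangentSpace (𝓡∂ (n + 1)) : c.W → Type)⟯)
        (_ : IsGradientLike (𝓡∂ (n + 1)) S.g₁ ξ₃)
        (_ : ∀ z, S.g₁ z ∉ Ioo S.c₀ S.c₁ → ξ₃ z = ξ z)
        (_ : ∀ x, S.g₁ x = S.c₁ → ∀ v : S.V, FlowsTo (𝓡∂ (n + 1)) ξ (S.ι v) x →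
          FlowsTo (𝓡∂ (n + 1)) ξ₃ (S.ι (F.toFun 1 v)) x)
        (_ : ∀ x, S.g₁ x = S.c₁ → ∀ v : S.V, FlowsTo (𝓡∂ (n + 1)) ξ₃ (S.ι v) x →
          ∃ v₀ : S.V, F.toFun 1 v₀ = v ∧ FlowsTo (𝓡∂ (n + 1)) ξ (S.ι v₀) x)
        (ν : ℝ → ℝ) (_ : Continuous ν) (_ : ν S.c₀ = 1) (_ : ν S.c₁ = 0) (_ : ∀ t, 0 ≤ ν t ∧ ν t ≤ 1)
        (t₁' t₂' : ℝ) (_ : S.c₀ < t₁') (_ : t₁' < t₂') (_ : t₂' < S.c₁)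
        (_ : ∀ t, ν t = Real.smoothTransition ((t₂' - t) / (t₂' - t₁')))
        (_ : ∀ q : S.V, ∀ τ ∈ Icc 0 (S.c₁ - S.c₀), ∃ y : c.W, S.g₁ y = S.c₀ + τ ∧
          FlowsTo (𝓡∂ (n + 1)) ξ (S.ι (F.toFun (ν (S.c₀ + τ)) q)) y ∧
          FlowsTo (𝓡∂ (n + 1)) ξ₃ (S.ι (F.toFun 1 q)) y)
        (_ : leftHandSphere (𝓡∂ (n + 1)) S.g₁ ξ₃ (σ i) S.c₀ = S.ι '' (F.toFun 1 '' S.leftSphere))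
        (_ : ∀ l : {l : Fin a // l ≠ i},
          rightHandSphere (𝓡∂ (n + 1)) S.g₁ ξ₃ (σ l) S.c₀ = S.ι '' S.rightSphere l)
        (_ : ∀ l : {l : Fin a // l ≠ i},
          Disjoint (trajectorySet (𝓡∂ (n + 1)) ξ₃ (σ l)) (trajectorySet (𝓡∂ (n + 1)) ξ₃ (σ i)))
        (g' : c.W → ℝ) (_ : c.IsMorseFunction g') (_ : IsGradientLike (𝓡∂ (n + 1)) g' ξ₃)
        (_ : criticalSet (𝓡∂ (n + 1)) g' = criticalSet (𝓡∂ (n + 1)) g)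
        (_ : ∀ z ∈ criticalSet (𝓡∂ (n + 1)) g, morseIndex (𝓡∂ (n + 1)) g' z = morseIndex (𝓡∂ (n + 1)) g z)
        (_ : ∀ l, g' (σ l) = b)
        (_ : ∀ᶠ z in 𝓝ˢ {z | S.g₁ z ∉ Ioo S.u S.v}, g' z = S.g₁ z)
        (_ : ∀ z, S.g₁ z ∈ Ioo S.u S.v → g' z ∈ Ioo S.u S.v)
        (_ : ∀ z, g z ∉ Ioo S.u S.v → g' z = g z)
        (_ : ∀ z, g z ∈ Ioo S.u S.v → g' z ∈ Ioo S.u S.v)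
        (_ : ∀ᶠ z in 𝓝 (σ i), g' z = S.g₁ z + (b - S.bP))
        (_ : ∀ l, l ≠ i → ∀ᶠ z in 𝓝 (σ l), g' z = S.g₁ z)
        (g𝔼 : HomologicalOrientation ℤ (EuclideanSpace ℝ (Fin k)) k),
      ∃ (Tj : TransverseDiscDatum ↥X k) (hDNj : Tj.disc ⊆ Tj.N),
        (∀ z : ↥X, z ∈ Tj.P ↔ (z : c.W) ∈ unstableSet (𝓡∂ (n + 1)) (⇑ξ) (σ j)) ∧
        (((Tj.m 0 : ↥X) : c.W) = σ j) ∧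
        (∀ z ∈ Tj.disc, (z : c.W) ∈ stableSet (𝓡∂ (n + 1)) (⇑ξ) (σ j)) ∧
        (Tj.disc ∈ 𝓝[{z : ↥X | (z : c.W) ∈ stableSet (𝓡∂ (n + 1)) (⇑ξ) (σ j)}] (Tj.m 0)) ∧
        (∀ (v : EuclideanSpace ℝ (Fin k)) (hv : v ∈ closedBall (0 : EuclideanSpace ℝ (Fin k)) Tj.r),
          Tj.K ⟨Tj.m v, hDNj (mem_image_of_mem _ hv)⟩ = v) ∧
        ∀ {A : Set ↥X} (hAj : A ⊆ Tj.Pᶜ)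
          (h₁' : leftHandDisc (𝓡∂ (n + 1)) g' ξ₃ (σ i) t₀ ⊆ X)
          (h₀' : MapsTo (Set.inclusion h₁')
            (Subtype.val ⁻¹' leftHandSphere (𝓡∂ (n + 1)) g' ξ₃ (σ i) t₀) A)
          (γ₀ : relativeSingularHomology ℤ ℤ ↥(leftHandDisc (𝓡∂ (n + 1)) g' ξ₃ (σ i) t₀)
            (Subtype.val ⁻¹' leftHandSphere (𝓡∂ (n + 1)) g' ξ₃ (σ i) t₀) k)
          (_ : ∃ φ : _ ≃ₗ[ℤ] ℤ, φ γ₀ = 1),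
          Tj.functional hAj k ((relativeSingularHomology.map ℤ ℤ
              (⟨Set.inclusion h₁', continuous_inclusion h₁'⟩ :
                C(↥(leftHandDisc (𝓡∂ (n + 1)) g' ξ₃ (σ i) t₀), ↥X)) h₀' k).hom γ₀) = Tj.baseClass g𝔼 ∨
            Tj.functional hAj k ((relativeSingularHomology.map ℤ ℤ
              (⟨Set.inclusion h₁', continuous_inclusion h₁'⟩ :
                C(↥(leftHandDisc (𝓡∂ (n + 1)) g' ξ₃ (σ i) t₀), ↥X)) h₀' k).hom γ₀) = -Tj.baseClass g𝔼 := by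
  intro n M N _ _ _ _ _ _ _ _ _ _ _ _ c g ξ t₀ t₁ b k a σ i j S ht₁ X hX ρ f hfW hfFlat Φ hΦsm hΦsm'
    hsph hother O hOo hOsub hO hcentre r₀ hr₀ hr₀sub δ α hδ hαs hαδ hα2δ hαb F hcross hformula hearly
    hend ξ₃ hξ₃ hξ₃eq hpush hpull ν hνc hν0 hν1 hν01 t₁' t₂' h01' h12 h2c hνt htrack hleft hright hdisj
    g' hg' hξg' hcrit' hind hval hnear hIoo halt halt' hlocI hlocO g𝔼
  ----------------------------------------------------------------------------------------------
  -- Step 0: bookkeeping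
  ----------------------------------------------------------------------------------------------
  have hreg := S.band_regular
  have hIcc0 : S.c₀ ∈ Icc S.c₀ S.c₁ := left_mem_Icc.2 S.hc₀c₁.le
  haveI : Nonempty S.V := ⟨S.discA ρ 0⟩
  have hνfun : ν = fun t => Real.smoothTransition ((t₂' - t) / (t₂' - t₁')) := funext hνt
  have hνs : ContDiff ℝ ∞ ν := by
    rw [hνfun]
    exact Real.smoothTransition.contDiff.comp ((contDiff_const.sub contDiff_id).div_const _)
  -- membership in the slab `X` and in the open slab `(u, v)` of points of the band
  have hband_uv : ∀ y : c.W, S.c₀ ≤ S.g₁ y → S.g₁ y < S.c₁ → S.g₁ y ∈ Ioo S.u S.v := fun y hy0 hy1 =>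
    ⟨S.huc₀.trans_le hy0, hy1.trans (S.hc₁bP.trans S.hbPv)⟩
  have hband_X : ∀ y : c.W, S.c₀ ≤ S.g₁ y → S.g₁ y < S.c₁ → y ∈ X := fun y hy0 hy1 =>
    (hX y).2 (Ioo_subset_Icc_self (S.Ioo_uv_subset (S.apply_mem_Ioo_of_apply₁_mem_Ioo (hband_uv y hy0 hy1))))
  ----------------------------------------------------------------------------------------------
  -- Step 1: the crossing chart (reaching the level `t₂'`)
  ----------------------------------------------------------------------------------------------
  obtain ⟨Vk, pstar, E, hE, hVko, hpstar, hEs, hemb, hopen, hstar, huniq, ⟨alo, ahi, halo, hahi, hVk⟩,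
      hEp, hx0, ha2, hνhalf, hlam⟩ :=
    S.exists_crossingChart ρ hsph hδ hαδ hξ₃ hξ₃eq hcross hformula hνs h01' h12 h2c hνt htrack hleft
      hIoo le_rfl h2c
  set astar : ℝ := (S.Lk.symm pstar).1 with hastar
  obtain ⟨hgstar, hastarI, hflowstar⟩ := hEp pstar hpstar
  rw [hx0] at hflowstar
  have hystarIoo : S.g₁ (E pstar) ∈ Ioo S.c₀ S.c₁ := by rw [hgstar]; exact hastarI
  -- the model point of the crossing on the level, `z⋆ = (2, 0, 0)`, and `Φ⁻¹ z⋆ ∈ S_R(σ j)`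
  set zstar : SlideSetting.Model n k :=
    ((2 : ℝ), (0 : EuclideanSpace ℝ (Fin (k - 1))), (0 : EuclideanSpace ℝ (Fin (n - k)))) with hzstar
  have hzstar_tgt : zstar ∈ Φ.target := hr₀sub (by show ‖(0 : EuclideanSpace ℝ (Fin (n - k)))‖ < r₀; rw [norm_zero]; exact hr₀)
  have hqV_src : Φ.symm zstar ∈ Φ.source := Φ.map_target hzstar_tgt
  have hFstar : F.toFun (ν astar) (S.discA ρ 0) = Φ.symm zstar := by
    rw [hformula (ν astar) hνhalf 0 S.Flat.zero_mem (by rw [norm_zero]; norm_num), S.preB_zero]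
    congr 1
    refine Prod.ext ?_ (Prod.ext rfl rfl)
    show 1 + Real.smoothTransition (2 * ν astar - 1) *
      (α (‖(0 : EuclideanSpace ℝ (Fin (k - 1)))‖ ^ 2) - 1) = 2
    rw [norm_zero, zero_pow two_ne_zero, hαδ 0 hδ.le, hlam]
    norm_num
  have hflow0 : FlowsTo (𝓡∂ (n + 1)) ξ (S.ι (Φ.symm zstar)) (E pstar) := by
    rw [← hFstar, ← S.psiL_sheet_zero ρ]; exact hflowstar
  -- points `ι(Φ⁻¹(2, 0, y))` lie on `S_R(σ j)`, hence on `W^u_ξ(σ j)`, on the level `c₀`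
  have hsphere : ∀ y : EuclideanSpace ℝ (Fin (n - k)),
      S.ι (Φ.symm (((2 : ℝ), (0 : EuclideanSpace ℝ (Fin (k - 1))), y) : SlideSetting.Model n k)) ∈
        unstableSet (𝓡∂ (n + 1)) ξ (σ j) := by
    intro y
    have h1 : Φ.symm (((2 : ℝ), (0 : EuclideanSpace ℝ (Fin (k - 1))), y) : SlideSetting.Model n k) ∈
        S.rightSphere S.jR := (hsph _).2 ⟨rfl, rfl⟩
    have h2 : S.ι (Φ.symm (((2 : ℝ), (0 : EuclideanSpace ℝ (Fin (k - 1))), y) : SlideSetting.Model n k)) ∈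
        rightHandSphere (𝓡∂ (n + 1)) S.g₁ ξ (σ j) S.c₀ := by
      rw [show σ j = σ (S.jR : Fin a) from rfl, ← S.image_rightSphere S.jR]
      exact ⟨_, h1, rfl⟩
    exact rightHandSphere_subset_unstableSet h2
  ----------------------------------------------------------------------------------------------
  -- Step 2: the flow-regular datum of `D_R(σ j)`, its box inside `{g₁ < c₀}`
  ----------------------------------------------------------------------------------------------
  have hcritg : ∀ z ∈ criticalSet (𝓡∂ (n + 1)) g, g z ∈ Icc t₀ t₁ →
      g z = b ∧ morseIndex (𝓡∂ (n + 1)) g z = k := by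
    intro z hz hzI
    obtain ⟨l, rfl⟩ := S.exists_eq_σ_of_mem_Icc hz hzI
    exact ⟨S.apply_σ l, S.morseIndex_σ l⟩
  have hσjmem : σ j ∈ criticalSet (𝓡∂ (n + 1)) g ∩ g ⁻¹' Icc t₀ t₁ := by
    rw [← S.range_σ]; exact mem_range_self j
  have hO'o : IsOpen {z : c.W | S.g₁ z < S.c₀} := isOpen_lt S.contMDiff_g₁.continuous continuous_const
  have hσjO' : σ j ∈ {z : c.W | S.g₁ z < S.c₀} := by
    show S.g₁ (σ j) < S.c₀
    rw [S.g₁_σ j (fun h => S.hij h.symm)]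
    exact S.hbc₀
  obtain ⟨Tj, hDNj, hPj, hm0j, hdstj, hnhdj, hKmj, R, Kt, hRo, hKts, hKtK, hKtinv, hKtrank, hRmem⟩ :=
    Cobordism.exists_flowRegular_transverseDiscDatum S.hg ξ S.hξ S.ht₀b S.hbt₁ ht₁ S.hk1 S.hkn' hcritg
      hσjmem hX hO'o hσjO'
  refine ⟨Tj, hDNj, hPj, hm0j, hdstj, hnhdj, hKmj, ?_⟩
  intro A hAj h₁' h₀' γ₀ hγ₀
  -- the region `R` contains `W^u_ξ(σ j) ∩ {c₀ ≤ g₁ < c₁}`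
  have hRmem' : ∀ y ∈ unstableSet (𝓡∂ (n + 1)) (⇑ξ) (σ j), S.c₀ ≤ S.g₁ y → S.g₁ y < S.c₁ → y ∈ R := by
    intro y hyu hy0 hy1
    refine hRmem y hyu (fun h => (not_lt.2 hy0) h) ?_
    exact (S.apply_mem_Ioo_of_apply₁_mem_Ioo (hband_uv y hy0 hy1)).2.trans S.hvt₁
  have hystarR : E pstar ∈ R := hRmem' _ hstar hystarIoo.1.le hystarIoo.2
  have hy₀R : ∀ y : EuclideanSpace ℝ (Fin (n - k)),
      S.ι (Φ.symm (((2 : ℝ), (0 : EuclideanSpace ℝ (Fin (k - 1))), y) : SlideSetting.Model n k)) ∈ R :=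
    fun y => hRmem' _ (hsphere y) (by rw [S.apply_ι]) (by rw [S.apply_ι]; exact S.hc₀c₁)
  -- `K̃ = 0` at these points
  have hKt0 : ∀ y : EuclideanSpace ℝ (Fin (n - k)),
      Kt (S.ι (Φ.symm (((2 : ℝ), (0 : EuclideanSpace ℝ (Fin (k - 1))), y) : SlideSetting.Model n k))) = 0 := by
    intro y
    have hXmem : S.ι (Φ.symm (((2 : ℝ), (0 : EuclideanSpace ℝ (Fin (k - 1))), y) : SlideSetting.Model n k)) ∈ X :=
      hband_X _ (by rw [S.apply_ι]) (by rw [S.apply_ι]; exact S.hc₀c₁)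
    obtain ⟨hN, hK⟩ := hKtK ⟨_, hXmem⟩ (hy₀R y)
    rw [← hK]
    exact (Tj.eq_zero_iff _).2 ((hPj _).2 (hsphere y))
  ----------------------------------------------------------------------------------------------
  -- Step 3: the map `G = K̃ ∘ ι ∘ Φ⁻¹` near `z⋆`, its derivative, and its vanishing directions
  ----------------------------------------------------------------------------------------------
  have hGsmooth : ContMDiffAt 𝓘(ℝ, SlideSetting.Model n k) 𝓘(ℝ, EuclideanSpace ℝ (Fin k)) ∞
      (fun z : SlideSetting.Model n k => Kt (S.ι (Φ.symm z))) zstar := by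
    have h1 : ContMDiffAt 𝓘(ℝ, SlideSetting.Model n k) (𝓡 n) ∞ Φ.symm zstar :=
      hΦsm'.contMDiffAt (Φ.open_target.mem_nhds hzstar_tgt)
    have h2 : ContMDiffAt (𝓡 n) (𝓡∂ (n + 1)) ∞ S.ι (Φ.symm zstar) := S.hι.contMDiff _
    have h3 : ContMDiffAt (𝓡∂ (n + 1)) 𝓘(ℝ, EuclideanSpace ℝ (Fin k)) ∞ Kt (S.ι (Φ.symm zstar)) :=
      hKts.contMDiffAt (hRo.mem_nhds (hy₀R 0))
    exact h3.comp zstar (h2.comp zstar h1)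
  have hGd : HasFDerivAt (fun z : SlideSetting.Model n k => Kt (S.ι (Φ.symm z)))
      (fderiv ℝ (fun z : SlideSetting.Model n k => Kt (S.ι (Φ.symm z))) zstar) zstar :=
    ((contMDiffAt_iff_contDiffAt.1 hGsmooth).differentiableAt (by simp)).hasFDerivAt
  set G' := fderiv ℝ (fun z : SlideSetting.Model n k => Kt (S.ι (Φ.symm z))) zstar with hG'
  -- `G` vanishes on `{(2, 0, y)}`, so `G'` kills the `y`-directions
  have hY : ∀ y : EuclideanSpace ℝ (Fin (n - k)), G' ((0 : ℝ), (0 : EuclideanSpace ℝ (Fin (k - 1))), y) = 0 := by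
    have haff : HasFDerivAt (fun y : EuclideanSpace ℝ (Fin (n - k)) =>
        (((2 : ℝ), (0 : EuclideanSpace ℝ (Fin (k - 1))), y) : SlideSetting.Model n k))
        ((0 : EuclideanSpace ℝ (Fin (n - k)) →L[ℝ] ℝ).prod
          ((0 : EuclideanSpace ℝ (Fin (n - k)) →L[ℝ] EuclideanSpace ℝ (Fin (k - 1))).prod
            (ContinuousLinearMap.id ℝ (EuclideanSpace ℝ (Fin (n - k)))))) 0 :=
      (hasFDerivAt_const _ _).prodMk ((hasFDerivAt_const _ _).prodMk (hasFDerivAt_id _))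
    have hcomp := hGd.comp (0 : EuclideanSpace ℝ (Fin (n - k))) haff
    have hzero : HasFDerivAt ((fun z : SlideSetting.Model n k => Kt (S.ι (Φ.symm z))) ∘
        fun y : EuclideanSpace ℝ (Fin (n - k)) =>
          (((2 : ℝ), (0 : EuclideanSpace ℝ (Fin (k - 1))), y) : SlideSetting.Model n k))
        (0 : EuclideanSpace ℝ (Fin (n - k)) →L[ℝ] EuclideanSpace ℝ (Fin k)) 0 :=
      (hasFDerivAt_const (0 : EuclideanSpace ℝ (Fin k)) (0 : EuclideanSpace ℝ (Fin (n - k)))).congr_of_eventuallyEq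
        (Eventually.of_forall fun y => hKt0 y)
    have heq := hcomp.unique hzero
    intro y
    have := congrArg (fun φ : EuclideanSpace ℝ (Fin (n - k)) →L[ℝ] EuclideanSpace ℝ (Fin k) => φ y) heq
    simpa using this
  ----------------------------------------------------------------------------------------------
  -- Step 4: `G'` is onto — a right inverse from the right-inverse germ of `K̃` at `y⋆`,
  -- projected to the level along the flow and read in the chart `Φ`
  ----------------------------------------------------------------------------------------------
  obtain ⟨m, hm0, hm⟩ := hKtrank (E pstar) hstar hystarR
  obtain ⟨θ, hθ⟩ := S.hg₁.exists_slabFlow ξ.contMDiff S.hξ₁ S.hc₀_pos S.hc₀c₁ S.hc₁_lt_one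
  have hθ' := hθ.toPreSlabFlow
  -- the level point of `y⋆` is `ι(Φ⁻¹ z⋆)`
  have hlev0 : Flow.levelProj θ S.g₁ S.c₀ (E pstar) = S.ι (Φ.symm zstar) :=
    (hθ'.eq_levelProj_of_flowsTo hreg hIcc0 (S.apply_ι _) (Ioo_subset_Icc_self hystarIoo) hflow0).symm
  have hinv0 : (Flow.prodInv θ S.g₁ S.ι S.c₀ (E pstar)).1 = Φ.symm zstar := by
    rw [Flow.prodInv_apply]
    show invFun S.ι (Flow.levelProj θ S.g₁ S.c₀ (E pstar)) = Φ.symm zstar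
    rw [hlev0]
    exact leftInverse_invFun S.injective_ι _
  have hmAt : ContMDiffAt 𝓘(ℝ, EuclideanSpace ℝ (Fin k)) (𝓡∂ (n + 1)) ∞ m 0 := hm.self_of_nhds.1
  have hPinv : ContMDiffAt (𝓡∂ (n + 1)) ((𝓡 n).prod 𝓘(ℝ, ℝ)) ∞ (Flow.prodInv θ S.g₁ S.ι S.c₀) (m 0) := by
    rw [hm0]; exact hθ.contMDiffAt_prodInv hreg S.hι hIcc0 S.range_ι hystarIoo
  have hfstAt : ContMDiffAt 𝓘(ℝ, EuclideanSpace ℝ (Fin k)) (𝓡 n) ∞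
      (fun w => (Flow.prodInv θ S.g₁ S.ι S.c₀ (m w)).1) 0 :=
    contMDiffAt_fst.comp 0 (hPinv.comp 0 hmAt)
  have hΦAt : ContMDiffAt (𝓡 n) 𝓘(ℝ, SlideSetting.Model n k) ∞ Φ
      ((fun w => (Flow.prodInv θ S.g₁ S.ι S.c₀ (m w)).1) 0) := by
    show ContMDiffAt (𝓡 n) 𝓘(ℝ, SlideSetting.Model n k) ∞ Φ (Flow.prodInv θ S.g₁ S.ι S.c₀ (m 0)).1
    rw [hm0, hinv0]
    exact hΦsm.contMDiffAt (Φ.open_source.mem_nhds hqV_src)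
  have hmtAt : ContMDiffAt 𝓘(ℝ, EuclideanSpace ℝ (Fin k)) 𝓘(ℝ, SlideSetting.Model n k) ∞
      (fun w => Φ (Flow.prodInv θ S.g₁ S.ι S.c₀ (m w)).1) 0 := hΦAt.comp 0 hfstAt
  have hmt0 : (fun w => Φ (Flow.prodInv θ S.g₁ S.ι S.c₀ (m w)).1) 0 = zstar := by
    show Φ (Flow.prodInv θ S.g₁ S.ι S.c₀ (m 0)).1 = zstar
    rw [hm0, hinv0]
    exact Φ.right_inv hzstar_tgt
  have hmtd : HasFDerivAt (fun w => Φ (Flow.prodInv θ S.g₁ S.ι S.c₀ (m w)).1)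
      (fderiv ℝ (fun w => Φ (Flow.prodInv θ S.g₁ S.ι S.c₀ (m w)).1) 0) 0 :=
    ((contMDiffAt_iff_contDiffAt.1 hmtAt).differentiableAt (by simp)).hasFDerivAt
  -- `G ∘ m̃ = id` near `0`
  have hGmt : ((fun z : SlideSetting.Model n k => Kt (S.ι (Φ.symm z))) ∘
      fun w => Φ (Flow.prodInv θ S.g₁ S.ι S.c₀ (m w)).1) =ᶠ[𝓝 0] id := by
    -- `g₁ (m w) ∈ (c₀, c₁)` near `0`
    have hmc : ContinuousAt m 0 := hmAt.continuousAt
    have hev1 : ∀ᶠ w in 𝓝 (0 : EuclideanSpace ℝ (Fin k)), S.g₁ (m w) ∈ Ioo S.c₀ S.c₁ := by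
      have hc : ContinuousAt (fun w => S.g₁ (m w)) 0 := (S.contMDiff_g₁.continuous.continuousAt).comp hmc
      refine hc.preimage_mem_nhds (isOpen_Ioo.mem_nhds ?_)
      show S.g₁ (m 0) ∈ Ioo S.c₀ S.c₁
      rw [hm0]; exact hystarIoo
    -- the level point lies in `Φ.source` and in `R` near `0`
    have hev2 : ∀ᶠ w in 𝓝 (0 : EuclideanSpace ℝ (Fin k)), (Flow.prodInv θ S.g₁ S.ι S.c₀ (m w)).1 ∈ Φ.source := by
      refine hfstAt.continuousAt.preimage_mem_nhds (Φ.open_source.mem_nhds ?_)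
      show (Flow.prodInv θ S.g₁ S.ι S.c₀ (m 0)).1 ∈ Φ.source
      rw [hm0, hinv0]; exact hqV_src
    have hev3 : ∀ᶠ w in 𝓝 (0 : EuclideanSpace ℝ (Fin k)), S.ι (Flow.prodInv θ S.g₁ S.ι S.c₀ (m w)).1 ∈ R := by
      have hc : ContinuousAt (fun w => S.ι (Flow.prodInv θ S.g₁ S.ι S.c₀ (m w)).1) 0 :=
        S.continuous_ι.continuousAt.comp hfstAt.continuousAt
      refine hc.preimage_mem_nhds (hRo.mem_nhds ?_)
      show S.ι (Flow.prodInv θ S.g₁ S.ι S.c₀ (m 0)).1 ∈ R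
      rw [hm0, hinv0]; exact hy₀R 0
    filter_upwards [hm, hev1, hev2, hev3] with w hw h1 h2 h3
    obtain ⟨-, hwR, hKw⟩ := hw
    show Kt (S.ι (Φ.symm (Φ (Flow.prodInv θ S.g₁ S.ι S.c₀ (m w)).1))) = w
    rw [Φ.left_inv h2]
    have hιeq : S.ι (Flow.prodInv θ S.g₁ S.ι S.c₀ (m w)).1 = Flow.levelProj θ S.g₁ S.c₀ (m w) := by
      rw [Flow.prodInv_apply]
      exact hθ'.apply_invFun_levelProj hreg hIcc0 S.range_ι (Ioo_subset_Icc_self h1)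
    have hfl : FlowsTo (𝓡∂ (n + 1)) (⇑ξ) (S.ι (Flow.prodInv θ S.g₁ S.ι S.c₀ (m w)).1) (m w) := by
      rw [hιeq]
      exact hθ'.flowsTo_levelProj hreg (Ioo_subset_Icc_self h1) hIcc0 h1.1.le
    rw [hKtinv _ _ h3 hwR hfl, hKw]
  have hGm : G'.comp (fderiv ℝ (fun w => Φ (Flow.prodInv θ S.g₁ S.ι S.c₀ (m w)).1) 0) =
      ContinuousLinearMap.id ℝ (EuclideanSpace ℝ (Fin k)) := by
    have hGd' : HasFDerivAt (fun z : SlideSetting.Model n k => Kt (S.ι (Φ.symm z))) G'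
        ((fun w => Φ (Flow.prodInv θ S.g₁ S.ι S.c₀ (m w)).1) 0) := by rw [hmt0]; exact hGd
    exact (hGd'.comp 0 hmtd).unique ((hasFDerivAt_id (0 : EuclideanSpace ℝ (Fin k))).congr_of_eventuallyEq hGmt)
  have hGmw : ∀ w, G' (fderiv ℝ (fun w => Φ (Flow.prodInv θ S.g₁ S.ι S.c₀ (m w)).1) 0 w) = w := fun w => by
    have := congrArg (fun φ : EuclideanSpace ℝ (Fin k) →L[ℝ] EuclideanSpace ℝ (Fin k) => φ w) hGm
    simpa using this
  ----------------------------------------------------------------------------------------------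
  -- Step 5: `K̃ ∘ E = G ∘ Ψ` near `p⋆`, with `Ψ(L_k(a, x)) = (1 + (3/2) λ(2ν(a) - 1), X(x), 0)`
  ----------------------------------------------------------------------------------------------
  -- the sheet coordinate and the sweep profile
  obtain ⟨X', hX'inj, hXd⟩ := S.exists_hasFDerivAt_sheetCoord
  obtain ⟨d, hd, hσd⟩ := hasDerivAt_sweepProfile (astar := astar) h12 (by rw [← hνt]; exact hlam)
  -- the linear coordinates `a`, `x` of `p = L_k(a, x)`
  set φ₁ : EuclideanSpace ℝ (Fin k) →L[ℝ] ℝ :=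
    (ContinuousLinearMap.fst ℝ ℝ (EuclideanSpace ℝ (Fin (k - 1)))).comp
      (S.Lk.symm : EuclideanSpace ℝ (Fin k) →L[ℝ] ℝ × EuclideanSpace ℝ (Fin (k - 1))) with hφ₁
  set φ₂ : EuclideanSpace ℝ (Fin k) →L[ℝ] EuclideanSpace ℝ (Fin (k - 1)) :=
    (ContinuousLinearMap.snd ℝ ℝ (EuclideanSpace ℝ (Fin (k - 1)))).comp
      (S.Lk.symm : EuclideanSpace ℝ (Fin k) →L[ℝ] ℝ × EuclideanSpace ℝ (Fin (k - 1))) with hφ₂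
  have hφ₁d : HasFDerivAt (fun p : EuclideanSpace ℝ (Fin k) => (S.Lk.symm p).1) φ₁ pstar := φ₁.hasFDerivAt
  have hφ₂d : HasFDerivAt (fun p : EuclideanSpace ℝ (Fin k) => (S.Lk.symm p).2) φ₂ pstar := φ₂.hasFDerivAt
  -- the map `Ψ` and its derivative at `p⋆`
  set Ψ : EuclideanSpace ℝ (Fin k) → SlideSetting.Model n k := fun p =>
    ((1 + Real.smoothTransition (2 * Real.smoothTransition ((t₂' - (S.Lk.symm p).1) / (t₂' - t₁')) - 1) *
        (5 / 2 - 1),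
      (S.preB ((univBall (0 : EuclideanSpace ℝ (Fin n)) S.rA).symm
        (S.L₃.symm (((0 : ℝ), (S.Lk.symm p).2, (0 : EuclideanSpace ℝ (Fin (n - k)))) : SlideSetting.Model n k)))).2.1,
      (0 : EuclideanSpace ℝ (Fin (n - k)))) : SlideSetting.Model n k) with hΨ
  have hXd' : HasFDerivAt (fun x : EuclideanSpace ℝ (Fin (k - 1)) =>
      (S.preB ((univBall (0 : EuclideanSpace ℝ (Fin n)) S.rA).symm
        (S.L₃.symm (((0 : ℝ), x, (0 : EuclideanSpace ℝ (Fin (n - k)))) : SlideSetting.Model n k)))).2.1) X'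
      ((fun p : EuclideanSpace ℝ (Fin k) => (S.Lk.symm p).2) pstar) := by
    show HasFDerivAt _ X' (S.Lk.symm pstar).2
    rw [hx0]; exact hXd
  have hσd' : HasDerivAt (fun a' : ℝ => 1 + Real.smoothTransition
      (2 * Real.smoothTransition ((t₂' - a') / (t₂' - t₁')) - 1) * (5 / 2 - 1)) d
      ((fun p : EuclideanSpace ℝ (Fin k) => (S.Lk.symm p).1) pstar) := hσd
  have hΨd : HasFDerivAt Ψ ((d • φ₁).prod ((X'.comp φ₂).prod (0 : EuclideanSpace ℝ (Fin k) →L[ℝ] EuclideanSpace ℝ (Fin (n - k))))) pstar := by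
    show HasFDerivAt (fun p : EuclideanSpace ℝ (Fin k) =>
      ((1 + Real.smoothTransition (2 * Real.smoothTransition ((t₂' - (S.Lk.symm p).1) / (t₂' - t₁')) - 1) *
          (5 / 2 - 1),
        (S.preB ((univBall (0 : EuclideanSpace ℝ (Fin n)) S.rA).symm
          (S.L₃.symm (((0 : ℝ), (S.Lk.symm p).2, (0 : EuclideanSpace ℝ (Fin (n - k)))) : SlideSetting.Model n k)))).2.1,
        (0 : EuclideanSpace ℝ (Fin (n - k)))) : SlideSetting.Model n k)) _ pstar
    exact (hσd'.comp_hasFDerivAt pstar hφ₁d).prodMk ((hXd'.comp pstar hφ₂d).prodMk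
      (hasFDerivAt_const (0 : EuclideanSpace ℝ (Fin (n - k))) pstar))
  have hΨstar : Ψ pstar = zstar := by
    have hA0 : (univBall (0 : EuclideanSpace ℝ (Fin n)) S.rA).symm 0 = 0 := by
      have h := (univBall (0 : EuclideanSpace ℝ (Fin n)) S.rA).left_inv (x := 0) (by rw [univBall_source]; trivial)
      rwa [univBall_apply_zero] at h
    show ((1 + Real.smoothTransition (2 * Real.smoothTransition ((t₂' - (S.Lk.symm pstar).1) / (t₂' - t₁')) - 1) *
        (5 / 2 - 1),
      (S.preB ((univBall (0 : EuclideanSpace ℝ (Fin n)) S.rA).symm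
        (S.L₃.symm (((0 : ℝ), (S.Lk.symm pstar).2, (0 : EuclideanSpace ℝ (Fin (n - k)))) : SlideSetting.Model n k)))).2.1,
      (0 : EuclideanSpace ℝ (Fin (n - k)))) : SlideSetting.Model n k) = zstar
    rw [hx0, ← hνt, hlam]
    rw [show S.L₃.symm (((0 : ℝ), (0 : EuclideanSpace ℝ (Fin (k - 1))), (0 : EuclideanSpace ℝ (Fin (n - k)))) :
      SlideSetting.Model n k) = 0 from map_zero _, hA0, S.preB_zero]
    refine Prod.ext ?_ (Prod.ext rfl rfl)
    show (1 : ℝ) + 2 / 3 * (5 / 2 - 1) = 2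
    norm_num
  have hGdΨ : HasFDerivAt (fun z : SlideSetting.Model n k => Kt (S.ι (Φ.symm z))) G' (Ψ pstar) := by
    rw [hΨstar]; exact hGd
  have hL : HasFDerivAt ((fun z : SlideSetting.Model n k => Kt (S.ι (Φ.symm z))) ∘ Ψ)
      (G'.comp ((d • φ₁).prod ((X'.comp φ₂).prod (0 : EuclideanSpace ℝ (Fin k) →L[ℝ] EuclideanSpace ℝ (Fin (n - k)))))) pstar :=
    hGdΨ.comp pstar hΨd
  -- `K̃ ∘ E = G ∘ Ψ` near `p⋆`
  have hEc : ContinuousAt E pstar := (hEs.continuousOn.continuousWithinAt hpstar).continuousAt (hVko.mem_nhds hpstar)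
  have hfeq : (fun p => Kt (E p)) =ᶠ[𝓝 pstar] ((fun z : SlideSetting.Model n k => Kt (S.ι (Φ.symm z))) ∘ Ψ) := by
    -- (E1) `p ∈ Vk`
    have hE1 : ∀ᶠ p in 𝓝 pstar, p ∈ Vk := hVko.mem_nhds hpstar
    -- (E2) `E p ∈ R`
    have hE2 : ∀ᶠ p in 𝓝 pstar, E p ∈ R := hEc.preimage_mem_nhds (hRo.mem_nhds hystarR)
    -- (E3) the sheet point lies in the ball of the squeeze
    have hshc : Continuous fun p : EuclideanSpace ℝ (Fin k) =>
        S.L₃.symm (((0 : ℝ), (S.Lk.symm p).2, (0 : EuclideanSpace ℝ (Fin (n - k)))) : SlideSetting.Model n k) :=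
      S.L₃.symm.continuous.comp (continuous_const.prodMk ((continuous_snd.comp S.Lk.symm.continuous).prodMk continuous_const))
    have hsh0 : S.L₃.symm (((0 : ℝ), (S.Lk.symm pstar).2, (0 : EuclideanSpace ℝ (Fin (n - k)))) : SlideSetting.Model n k) = 0 := by
      rw [hx0]; exact map_zero _
    have hE3 : ∀ᶠ p in 𝓝 pstar,
        S.L₃.symm (((0 : ℝ), (S.Lk.symm p).2, (0 : EuclideanSpace ℝ (Fin (n - k)))) : SlideSetting.Model n k) ∈
          ball (0 : EuclideanSpace ℝ (Fin n)) S.rA := by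
      refine hshc.continuousAt.preimage_mem_nhds (isOpen_ball.mem_nhds ?_)
      rw [hsh0]; exact mem_ball_self S.rA_pos
    -- (E4) the docked flat vector has norm `≤ 1/8`
    have hvc : ContinuousAt (fun p : EuclideanSpace ℝ (Fin k) => (univBall (0 : EuclideanSpace ℝ (Fin n)) S.rA).symm
        (S.L₃.symm (((0 : ℝ), (S.Lk.symm p).2, (0 : EuclideanSpace ℝ (Fin (n - k)))) : SlideSetting.Model n k))) pstar := by
      refine ContinuousAt.comp ?_ hshc.continuousAt
      rw [hsh0]
      exact (univBall (0 : EuclideanSpace ℝ (Fin n)) S.rA).continuousAt_symm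
        (by rw [univBall_target _ S.rA_pos]; exact mem_ball_self S.rA_pos)
    have hv0 : (univBall (0 : EuclideanSpace ℝ (Fin n)) S.rA).symm
        (S.L₃.symm (((0 : ℝ), (S.Lk.symm pstar).2, (0 : EuclideanSpace ℝ (Fin (n - k)))) : SlideSetting.Model n k)) = 0 := by
      rw [hsh0]
      have h := (univBall (0 : EuclideanSpace ℝ (Fin n)) S.rA).left_inv (x := 0) (by rw [univBall_source]; trivial)
      rwa [univBall_apply_zero] at h
    have hE4 : ∀ᶠ p in 𝓝 pstar, ‖(univBall (0 : EuclideanSpace ℝ (Fin n)) S.rA).symm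
        (S.L₃.symm (((0 : ℝ), (S.Lk.symm p).2, (0 : EuclideanSpace ℝ (Fin (n - k)))) : SlideSetting.Model n k))‖ < 1 / 8 := by
      refine hvc.norm.eventually_lt continuousAt_const ?_
      show ‖(univBall (0 : EuclideanSpace ℝ (Fin n)) S.rA).symm
        (S.L₃.symm (((0 : ℝ), (S.Lk.symm pstar).2, (0 : EuclideanSpace ℝ (Fin (n - k)))) : SlideSetting.Model n k))‖ < 1 / 8
      rw [hv0, norm_zero]; norm_num
    -- (E5) the sweep time is `≥ 1/2`
    have hνstar : 1 / 2 < ν astar := by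
      have hI := SlideSetting.mem_Ioo_of_smoothTransition_mem_Ioo (x := 2 * ν astar - 1)
        (by rw [hlam]; norm_num) (by rw [hlam]; norm_num)
      linarith [hI.1]
    have hE5 : ∀ᶠ p in 𝓝 pstar, 1 / 2 < ν (S.Lk.symm p).1 := by
      have hc : ContinuousAt (fun p : EuclideanSpace ℝ (Fin k) => ν (S.Lk.symm p).1) pstar :=
        (hνc.comp (continuous_fst.comp S.Lk.symm.continuous)).continuousAt
      exact continuousAt_const.eventually_lt hc hνstar
    -- (E6) the isotoped sheet point, on the level, lies in `R`
    have hqc : ContinuousAt (fun p : EuclideanSpace ℝ (Fin k) =>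
        S.ι (F.toFun (ν (S.Lk.symm p).1) (S.psiL ρ (((0 : ℝ), (S.Lk.symm p).2,
          (0 : EuclideanSpace ℝ (Fin (n - k)))) : SlideSetting.Model n k)))) pstar := by
      have hF : Continuous (uncurry F.toFun) := F.contMDiff.continuous
      have hνp : Continuous fun p : EuclideanSpace ℝ (Fin k) => ν (S.Lk.symm p).1 :=
        hνc.comp (continuous_fst.comp S.Lk.symm.continuous)
      have hsrc : (((0 : ℝ), (S.Lk.symm pstar).2, (0 : EuclideanSpace ℝ (Fin (n - k)))) : SlideSetting.Model n k) ∈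
          (S.psiL ρ).source := by
        rw [S.mem_psiL_source_iff, hx0]
        simpa using S.xL_mem_target
      have hA : ContinuousAt (fun p : EuclideanSpace ℝ (Fin k) => S.psiL ρ (((0 : ℝ), (S.Lk.symm p).2,
          (0 : EuclideanSpace ℝ (Fin (n - k)))) : SlideSetting.Model n k)) pstar := by
        refine ContinuousAt.comp ((S.psiL ρ).continuousAt hsrc) ?_
        exact (continuous_const.prodMk ((continuous_snd.comp S.Lk.symm.continuous).prodMk continuous_const)).continuousAt
      exact S.continuous_ι.continuousAt.comp (hF.continuousAt.comp (hνp.continuousAt.prodMk hA))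
    have hq0 : S.ι (F.toFun (ν (S.Lk.symm pstar).1) (S.psiL ρ (((0 : ℝ), (S.Lk.symm pstar).2,
        (0 : EuclideanSpace ℝ (Fin (n - k)))) : SlideSetting.Model n k))) = S.ι (Φ.symm zstar) := by
      rw [hx0, S.psiL_sheet_zero ρ]
      show S.ι (F.toFun (ν astar) (S.discA ρ 0)) = _
      rw [hFstar]
    have hE6 : ∀ᶠ p in 𝓝 pstar, S.ι (F.toFun (ν (S.Lk.symm p).1) (S.psiL ρ (((0 : ℝ), (S.Lk.symm p).2,
        (0 : EuclideanSpace ℝ (Fin (n - k)))) : SlideSetting.Model n k))) ∈ R := by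
      refine hqc.preimage_mem_nhds (hRo.mem_nhds ?_)
      rw [hq0]; exact hy₀R 0
    -- (E7) the sheet coordinate is small: `α = 5/2` there
    have hE7 : ∀ᶠ p in 𝓝 pstar, ‖(S.preB ((univBall (0 : EuclideanSpace ℝ (Fin n)) S.rA).symm
        (S.L₃.symm (((0 : ℝ), (S.Lk.symm p).2, (0 : EuclideanSpace ℝ (Fin (n - k)))) : SlideSetting.Model n k)))).2.1‖ ^ 2 < δ := by
      have hc : ContinuousAt (fun p : EuclideanSpace ℝ (Fin k) => ‖(S.preB ((univBall (0 : EuclideanSpace ℝ (Fin n)) S.rA).symm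
          (S.L₃.symm (((0 : ℝ), (S.Lk.symm p).2, (0 : EuclideanSpace ℝ (Fin (n - k)))) : SlideSetting.Model n k)))).2.1‖ ^ 2) pstar :=
        ((continuous_fst.comp continuous_snd).continuousAt.comp (S.continuous_preB.continuousAt.comp hvc)).norm.pow 2
      have h0 : ‖(S.preB ((univBall (0 : EuclideanSpace ℝ (Fin n)) S.rA).symm
          (S.L₃.symm (((0 : ℝ), (S.Lk.symm pstar).2, (0 : EuclideanSpace ℝ (Fin (n - k)))) : SlideSetting.Model n k)))).2.1‖ ^ 2 = 0 := by
        rw [hv0, S.preB_zero]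
        simp
      refine hc.eventually_lt continuousAt_const ?_
      show ‖(S.preB ((univBall (0 : EuclideanSpace ℝ (Fin n)) S.rA).symm
          (S.L₃.symm (((0 : ℝ), (S.Lk.symm pstar).2, (0 : EuclideanSpace ℝ (Fin (n - k)))) : SlideSetting.Model n k)))).2.1‖ ^ 2 < δ
      rw [h0]; exact hδ
    filter_upwards [hE1, hE2, hE3, hE4, hE5, hE6, hE7] with p h1 h2 h3 h4 h5 h6 h7
    -- abbreviations
    obtain ⟨hgp, hpI, hflowp⟩ := hEp p h1
    set x : EuclideanSpace ℝ (Fin (k - 1)) := (S.Lk.symm p).2 with hxdef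
    set v : EuclideanSpace ℝ (Fin n) := (univBall (0 : EuclideanSpace ℝ (Fin n)) S.rA).symm
      (S.L₃.symm (((0 : ℝ), x, (0 : EuclideanSpace ℝ (Fin (n - k)))) : SlideSetting.Model n k)) with hvdef
    obtain ⟨hAx, hvF⟩ := S.discA_symm_sheet ρ h3
    -- flow invariance of `K̃`
    have hK1 : Kt (E p) = Kt (S.ι (F.toFun (ν (S.Lk.symm p).1) (S.psiL ρ (((0 : ℝ), x,
        (0 : EuclideanSpace ℝ (Fin (n - k)))) : SlideSetting.Model n k)))) :=
      (hKtinv _ _ h6 h2 hflowp).symm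
    -- the formula of the isotopy at the docked flat vector
    have hΨp : Ψ p = ((1 + Real.smoothTransition (2 * ν (S.Lk.symm p).1 - 1) * (5 / 2 - 1),
        (S.preB v).2.1, (0 : EuclideanSpace ℝ (Fin (n - k)))) : SlideSetting.Model n k) := by
      simp only [hΨ, hνt, hvdef, hxdef]
    show Kt (E p) = Kt (S.ι (Φ.symm (Ψ p)))
    rw [hK1, hΨp, ← hAx, hformula _ h5.le v hvF h4.le, hαδ _ h7.le]
  have hfd : HasFDerivAt (fun p => Kt (E p))
      (G'.comp ((d • φ₁).prod ((X'.comp φ₂).prod (0 : EuclideanSpace ℝ (Fin k) →L[ℝ] EuclideanSpace ℝ (Fin (n - k)))))) pstar :=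
    hL.congr_of_eventuallyEq hfeq
  ----------------------------------------------------------------------------------------------
  -- Step 6: the derivative is invertible; conclude by the crossing formula
  ----------------------------------------------------------------------------------------------
  have hLdet : LinearMap.det ((G'.comp ((d • φ₁).prod ((X'.comp φ₂).prod
      (0 : EuclideanSpace ℝ (Fin k) →L[ℝ] EuclideanSpace ℝ (Fin (n - k)))))) :
        EuclideanSpace ℝ (Fin k) →ₗ[ℝ] EuclideanSpace ℝ (Fin k)) ≠ 0 :=
    crossing_det_ne_zero S.hk1 G' _ hGmw hY hd.ne X' hX'inj S.Lk.symm
  -- the datum's `K` agrees with `K̃ ∘ E` near `p⋆`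
  have hf : ∀ᶠ w in 𝓝 pstar, ∀ (hw : w ∈ Vk) (hN : (⟨E w, h₁' (hE w hw)⟩ : ↥X) ∈ Tj.N),
      (fun p => Kt (E p)) w = Tj.K ⟨⟨E w, h₁' (hE w hw)⟩, hN⟩ := by
    filter_upwards [hEc.preimage_mem_nhds (hRo.mem_nhds hystarR)] with w hw hwV hN
    obtain ⟨hN', hK⟩ := hKtK ⟨E w, h₁' (hE w hwV)⟩ hw
    exact hK.symm
  -- the hypotheses on the new pair at `σ i`
  have hpk : σ i ∈ criticalSetOfIndex (𝓡∂ (n + 1)) g' k := by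
    refine ⟨?_, ?_⟩
    · have : σ i ∈ criticalSet (𝓡∂ (n + 1)) g' := by rw [hcrit']; exact S.σ_mem_criticalSet i
      exact this
    · rw [hind _ (S.σ_mem_criticalSet i), S.morseIndex_σ i]
  have htp : t₀ < g' (σ i) := by rw [hval i]; exact S.ht₀b
  have hnoval : ∀ z ∈ criticalSet (𝓡∂ (n + 1)) g', g' z ∉ Ico t₀ (g' (σ i)) := fun z hz => by
    rw [hval i]; exact S.apply_notMem_Ico_of_mem_criticalSet hcrit' hval halt hz
  have hlev : g' (E pstar) ≠ t₀ := by
    have h1 : g' (E pstar) ∈ Ioo S.u S.v := hIoo _ (hband_uv _ hystarIoo.1.le hystarIoo.2)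
    exact (S.ht₀u.trans h1.1).ne'
  exact Cobordism.functional_newDisc_crossing_eq_or_eq_neg' (⇑ξ) hg' ξ₃ hξg' S.ht₀ hpk htp hnoval h₁' h₀'
    Tj hAj hPj hVko hpstar E hE hemb hopen hstar hlev huniq (fun p => Kt (E p)) hf hfd hLdet g𝔼 γ₀ hγ₀

/-- **Milnor's Thm. 7.6 on a slab from the sign comparison of the two dockings alone**: with
`HV` proved (`Cobordism.slideStep_crossingValue`), the reduction
`Cobordism.Milnor1965_basisTheorem_slab_of_crossingValue_of_crossingSign` leaves only `HSgn`
(*"with intersection number `D_R(p₂) · D_L'(p₁) = +1`"*, the sign being the choice of the frame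
`μ(b)` of Lemma 7.7 — the docking `ρ`). [cite: MilnorHCobordism1965, Thm. 7.6 and its proof with Lemma 7.7 (PDF pp. 50–52)] -/
theorem Cobordism.Milnor1965_basisTheorem_slab_of_crossingSign
    (HSgn : ∀ {n : ℕ} {M N : Type u} [TopologicalSpace M] [T2Space M] [SecondCountableTopology M]
      [ChartedSpace (EuclideanSpace ℝ (Fin n)) M] [IsManifold (𝓡 n) ∞ M] [CompactSpace M]
      [TopologicalSpace N] [T2Space N] [SecondCountableTopology N]
      [ChartedSpace (EuclideanSpace ℝ (Fin n)) N] [IsManifold (𝓡 n) ∞ N] [CompactSpace N]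
      {c : Cobordism n M N} {g : c.W → ℝ}
      {ξ : Cₛ^∞⟮𝓡∂ (n + 1); EuclideanSpace ℝ (Fin (n + 1)), (TangentSpace (𝓡∂ (n + 1)) : c.W → Type)⟯}
      {t₀ t₁ b : ℝ} {k a : ℕ} {σ : Fin a → c.W} {i j : Fin a}
      (S : SlideSetting c g ξ t₀ t₁ b k σ i j) (_ : t₁ < 1)
      {X : Set c.W} (_ : ∀ z, z ∈ X ↔ g z ∈ Icc t₀ t₁)
      {A : Set ↥X} (_ : ∀ z : ↥X, z ∈ A ↔ g z = t₀)
      (e : Module.Basis (Fin a) ℤ (relativeSingularHomology ℤ ℤ ↥X A k))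
      (_ : ∀ l, ∃ (h₁ : leftHandDisc (𝓡∂ (n + 1)) g ξ (σ l) t₀ ⊆ X)
        (h₀ : MapsTo (Set.inclusion h₁)
          (Subtype.val ⁻¹' leftHandSphere (𝓡∂ (n + 1)) g ξ (σ l) t₀) A),
        ∃ γ, (relativeSingularHomology.map ℤ ℤ
          (⟨Set.inclusion h₁, continuous_inclusion h₁⟩ :
            C(↥(leftHandDisc (𝓡∂ (n + 1)) g ξ (σ l) t₀), ↥X)) h₀ k).hom γ = e l)
      (g𝔼 : HomologicalOrientation ℤ (EuclideanSpace ℝ (Fin k)) k),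
      ∃ ρ : (EuclideanSpace ℝ (Fin (k - 1))) ≃ₗᵢ[ℝ] EuclideanSpace ℝ (Fin (k - 1)),
      ∀ (f : S.V ≃ₘ⟮𝓡 n, 𝓡 n⟯ S.V) (_ : Diffeomorph.IsCompactlyDiffeotopicToIdIn S.W f)
        (_ : ∀ v ∈ S.Flat, ‖v‖ ≤ 1 → f (S.discA ρ v) = S.discB v)
        (Φ : OpenPartialHomeomorph S.V (SlideSetting.Model n k))
        (_ : ContMDiffOn (𝓡 n) 𝓘(ℝ, SlideSetting.Model n k) ∞ Φ Φ.source)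
        (_ : ContMDiffOn 𝓘(ℝ, SlideSetting.Model n k) (𝓡 n) ∞ Φ.symm Φ.target)
        (_ : ∀ z, Φ.symm z ∈ S.rightSphere S.jR ↔ z.1 = 2 ∧ z.2.1 = 0)
        (_ : ∀ l, l ≠ S.jR → ∀ z, Φ.symm z ∉ S.rightSphere l)
        (O : Set (SlideSetting.Model n k)) (_ : IsOpen O) (_ : {z | z.1 = 2 ∧ z.2.1 = 0} ⊆ O)
        (_ : ∀ z ∈ O, Φ.symm z = S.psiR z)
        (_ : ∀ v : EuclideanSpace ℝ (Fin n), ‖v‖ ≤ 1 / 8 →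
          S.preB v ∈ Φ.target ∧ Φ.symm (S.preB v) = S.discB v)
        (r₀ : ℝ) (_ : 0 < r₀) (_ : {z : SlideSetting.Model n k | ‖z.2.2‖ < r₀} ⊆ Φ.target)
        (δ : ℝ) (α : ℝ → ℝ) (_ : 0 < δ) (_ : ContDiff ℝ ∞ α) (_ : ∀ u, u ≤ δ → α u = 5 / 2)
        (_ : ∀ u, 2 * δ ≤ u → α u = 1) (_ : ∀ u, 1 ≤ α u ∧ α u ≤ 5 / 2)
        (F : AmbientIsotopy (𝓡 n) S.V)
        (_ : ∀ t, ∀ p ∈ S.leftSphere, ∀ l, F.toFun t p ∈ S.rightSphere l →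
          l = S.jR ∧ p = S.discA ρ 0 ∧ 1 / 2 ≤ t ∧ Real.smoothTransition (2 * t - 1) = 2 / 3)
        (_ : ∀ t, 1 / 2 ≤ t → ∀ v ∈ S.Flat, ‖v‖ ≤ 1 / 8 →
          F.toFun t (S.discA ρ v) = Φ.symm
            ((1 + Real.smoothTransition (2 * t - 1) * (α (‖(S.preB v).2.1‖ ^ 2) - 1),
              (S.preB v).2.1, (0 : EuclideanSpace ℝ (Fin (n - k)))) : SlideSetting.Model n k))
        (_ : ∀ t, t ≤ 1 / 2 → ∀ p ∈ S.W, F.toFun t p ∈ S.W)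
        (_ : F.toFun 1 '' S.leftSphere ⊆ S.W)
        (ξ₃ : Cₛ^∞⟮𝓡∂ (n + 1); EuclideanSpace ℝ (Fin (n + 1)), (TangentSpace (𝓡∂ (n + 1)) : c.W → Type)⟯)
        (_ : IsGradientLike (𝓡∂ (n + 1)) S.g₁ ξ₃)
        (_ : ∀ z, S.g₁ z ∉ Ioo S.c₀ S.c₁ → ξ₃ z = ξ z)
        (_ : ∀ x, S.g₁ x = S.c₁ → ∀ v : S.V, FlowsTo (𝓡∂ (n + 1)) ξ (S.ι v) x →
          FlowsTo (𝓡∂ (n + 1)) ξ₃ (S.ι (F.toFun 1 v)) x)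
        (_ : ∀ x, S.g₁ x = S.c₁ → ∀ v : S.V, FlowsTo (𝓡∂ (n + 1)) ξ₃ (S.ι v) x →
          ∃ v₀ : S.V, F.toFun 1 v₀ = v ∧ FlowsTo (𝓡∂ (n + 1)) ξ (S.ι v₀) x)
        (ν : ℝ → ℝ) (_ : Continuous ν) (_ : ν S.c₀ = 1) (_ : ν S.c₁ = 0) (_ : ∀ t, 0 ≤ ν t ∧ ν t ≤ 1)
        (t₁' t₂' : ℝ) (_ : S.c₀ < t₁') (_ : t₁' < t₂') (_ : t₂' < S.c₁)
        (_ : ∀ t, ν t = Real.smoothTransition ((t₂' - t) / (t₂' - t₁')))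
        (_ : ∀ q : S.V, ∀ τ ∈ Icc 0 (S.c₁ - S.c₀), ∃ y : c.W, S.g₁ y = S.c₀ + τ ∧
          FlowsTo (𝓡∂ (n + 1)) ξ (S.ι (F.toFun (ν (S.c₀ + τ)) q)) y ∧
          FlowsTo (𝓡∂ (n + 1)) ξ₃ (S.ι (F.toFun 1 q)) y)
        (_ : leftHandSphere (𝓡∂ (n + 1)) S.g₁ ξ₃ (σ i) S.c₀ = S.ι '' (F.toFun 1 '' S.leftSphere))
        (_ : ∀ l : {l : Fin a // l ≠ i},
          rightHandSphere (𝓡∂ (n + 1)) S.g₁ ξ₃ (σ l) S.c₀ = S.ι '' S.rightSphere l)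
        (_ : ∀ l : {l : Fin a // l ≠ i},
          Disjoint (trajectorySet (𝓡∂ (n + 1)) ξ₃ (σ l)) (trajectorySet (𝓡∂ (n + 1)) ξ₃ (σ i)))
        (g' : c.W → ℝ) (_ : c.IsMorseFunction g') (_ : IsGradientLike (𝓡∂ (n + 1)) g' ξ₃)
        (_ : criticalSet (𝓡∂ (n + 1)) g' = criticalSet (𝓡∂ (n + 1)) g)
        (_ : ∀ z ∈ criticalSet (𝓡∂ (n + 1)) g, morseIndex (𝓡∂ (n + 1)) g' z = morseIndex (𝓡∂ (n + 1)) g z)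
        (_ : ∀ l, g' (σ l) = b)
        (_ : ∀ᶠ z in 𝓝ˢ {z | S.g₁ z ∉ Ioo S.u S.v}, g' z = S.g₁ z)
        (_ : ∀ z, S.g₁ z ∈ Ioo S.u S.v → g' z ∈ Ioo S.u S.v)
        (_ : ∀ z, g z ∉ Ioo S.u S.v → g' z = g z)
        (_ : ∀ z, g z ∈ Ioo S.u S.v → g' z ∈ Ioo S.u S.v)
        (_ : ∀ᶠ z in 𝓝 (σ i), g' z = S.g₁ z + (b - S.bP))
        (_ : ∀ l, l ≠ i → ∀ᶠ z in 𝓝 (σ l), g' z = S.g₁ z),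
      ∀ (Ti Tj : TransverseDiscDatum ↥X k) (hDNi : Ti.disc ⊆ Ti.N) (hDNj : Tj.disc ⊆ Tj.N)
        (_ : ∀ z : ↥X, z ∈ Ti.P ↔ (z : c.W) ∈ unstableSet (𝓡∂ (n + 1)) (⇑ξ) (σ i))
        (_ : (((Ti.m 0 : ↥X) : c.W) = σ i))
        (_ : ∀ z ∈ Ti.disc, (z : c.W) ∈ stableSet (𝓡∂ (n + 1)) (⇑ξ) (σ i))
        (_ : Ti.disc ∈ 𝓝[{z : ↥X | (z : c.W) ∈ stableSet (𝓡∂ (n + 1)) (⇑ξ) (σ i)}] (Ti.m 0))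
        (_ : ∀ (v : EuclideanSpace ℝ (Fin k)) (hv : v ∈ closedBall (0 : EuclideanSpace ℝ (Fin k)) Ti.r),
          Ti.K ⟨Ti.m v, hDNi (mem_image_of_mem _ hv)⟩ = v)
        (_ : ∀ z : ↥X, z ∈ Tj.P ↔ (z : c.W) ∈ unstableSet (𝓡∂ (n + 1)) (⇑ξ) (σ j))
        (_ : (((Tj.m 0 : ↥X) : c.W) = σ j))
        (_ : ∀ z ∈ Tj.disc, (z : c.W) ∈ stableSet (𝓡∂ (n + 1)) (⇑ξ) (σ j))
        (_ : Tj.disc ∈ 𝓝[{z : ↥X | (z : c.W) ∈ stableSet (𝓡∂ (n + 1)) (⇑ξ) (σ j)}] (Tj.m 0))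
        (_ : ∀ (v : EuclideanSpace ℝ (Fin k)) (hv : v ∈ closedBall (0 : EuclideanSpace ℝ (Fin k)) Tj.r),
          Tj.K ⟨Tj.m v, hDNj (mem_image_of_mem _ hv)⟩ = v)
        (h₁' : leftHandDisc (𝓡∂ (n + 1)) g' ξ₃ (σ i) t₀ ⊆ X)
        (h₀' : MapsTo (Set.inclusion h₁')
          (Subtype.val ⁻¹' leftHandSphere (𝓡∂ (n + 1)) g' ξ₃ (σ i) t₀) A)
        (γ₀ : relativeSingularHomology ℤ ℤ ↥(leftHandDisc (𝓡∂ (n + 1)) g' ξ₃ (σ i) t₀)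
          (Subtype.val ⁻¹' leftHandSphere (𝓡∂ (n + 1)) g' ξ₃ (σ i) t₀) k)
        (_ : ∃ φ : _ ≃ₗ[ℤ] ℤ, φ γ₀ = 1)
        (hAi : A ⊆ Ti.Pᶜ) (hAj : A ⊆ Tj.Pᶜ) (ui uj ti tj : ℤ)
        (_ : ui = 1 ∨ ui = -1) (_ : uj = 1 ∨ uj = -1) (_ : ti = 1 ∨ ti = -1) (_ : tj = 1 ∨ tj = -1)
        (_ : Ti.functional hAi k (e i) = ui • Ti.baseClass g𝔼)
        (_ : Tj.functional hAj k (e j) = uj • Tj.baseClass g𝔼)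
        (_ : Ti.functional hAi k ((relativeSingularHomology.map ℤ ℤ
              (⟨Set.inclusion h₁', continuous_inclusion h₁'⟩ :
                C(↥(leftHandDisc (𝓡∂ (n + 1)) g' ξ₃ (σ i) t₀), ↥X)) h₀' k).hom γ₀) = ti • Ti.baseClass g𝔼)
        (_ : Tj.functional hAj k ((relativeSingularHomology.map ℤ ℤ
              (⟨Set.inclusion h₁', continuous_inclusion h₁'⟩ :
                C(↥(leftHandDisc (𝓡∂ (n + 1)) g' ξ₃ (σ i) t₀), ↥X)) h₀' k).hom γ₀) = tj • Tj.baseClass g𝔼),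
        ui * ti = uj * tj) :
    Cobordism.Milnor1965_basisTheorem_slab.{u} :=
  Cobordism.Milnor1965_basisTheorem_slab_of_crossingValue_of_crossingSign Cobordism.slideStep_crossingValue HSgn

end Literature.Topology.FourManifolds

end
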